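import Mathlib
import HarnessLib
import HarnessLib.Audit
import Summits.AtomisticToContinuum.Statement
import Literature.Geometry.DiscreteGeometry.KissingPatterns
import Summits.AtomisticToContinuum.Crystallization.Theorems.ExcessDecayLiouvilleCrysEnergyLimit
import HarnessLib.Audit.Status.Attr

/-!
Route: TwoCentreKissingKernel

DORMANT since 2026-08-25T15:20:43Z (reconciler: no traction for 7.8 d (last activity item-evidence-added at 2026-08-17T19:18:23Z); parked, not closed — `ledger route dormant route-AtomisticToContinuum-TwoCentreKissingKernel --off` to re) — unstaffed, not closed; items shared with open routes are served there. `ledger route dormant <id> --off` reactivates.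

# Route TwoCentreKissingKernel — Flatley–Theil's two-centre kissing conjecture as the gap-free
rigidity kernel carrying Lennard-Jones bond order to crystallization

Conforming successor (D-0027 §2.1) of the retired route TwoCentreKissing; realises card
flatley-theil-conjecture-two-sphere-sdp (spine). It suffices to show X = X_geo ∧ X_LJ ∧ X_hinge ∧
X_(i):
X_geo (GAP-FREE KERNEL, pure metric geometry, no potential, no empty-annulus hypothesis):
Flatley–Theil's
Conjecture 2.2 — two touching points of a 1-separated set, each with exactly twelve unit-distance
neighbours,
share ≥ 4 neighbours (TwoCentreFourCommon) — in soft form at tolerance η ≤ 10⁻³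
(SoftTwoCentreFourCommon) plus
effective 24-tangency rigidity (RobustTangencyBound) give GapFreeShellRigidity: a point whose soft
neighbours are
all exactly-twelve soft-coordinated has a shell 1/10-close to the FCC or HCP kissing pattern.
X_LJ (BOND ORDER, first shell only): Lennard-Jones ground states in ℝ³ have one bond length a — all
but o(N)
particles are (1−10⁻³)a-separated and exactly twelve-coordinated within (1+10⁻³)a (BondOrderTwelve);
with X_geo
this is the target LocalClosePacking (glue BondToShells). X_hinge: LocalClosePacking →
IsCrystallizing lennardJones 3
(ClosePackedCrystallizes: layering + stacking selection). X_(i): the shared conjunct-(i) items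
CrysPeriodicMinAttained
(= stmt-0627) and CrysEnergyLimit (= stmt-0626). The deciding theorem `closes` is five lines of
logic (IsLeast.csInf_eq).
Lean: `LocalClosePacking ∧ ClosePackedCrystallizes ∧ CrysPeriodicMinAttained ∧ CrysEnergyLimit`

## Assembly
Pure logic, certified sorry-free in Sketch.lean and as glue.lean (`closes`, axioms
propext/Classical.choice/Quot.sound):
BondToShells turns BondOrderTwelve + GapFreeShellRigidity into LocalClosePacking;
ClosePackedCrystallizes gives
IsCrystallizing lennardJones 3; CrysPeriodicMinAttained supplies a least periodic configuration P,
whose value is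
the ⨅ (IsLeast.csInf_eq), so CrysEnergyLimit is the limit statement of HasPeriodicGroundStateEnergy;
the pair is
`_root_.Crystallization` by definition. TwoCentreFourCommon heads the chain as the η = 0 section of
the kernel's
input and the route's kill switch (a hypothesis of `closes` like every item, not consumed by its
proof term).

Rationale: WHY THIS LINE. Flatley–Theil (arXiv:1407.0692, §2.1 p. 7) print ONE finite geometric statement,
Conjecture 2.2, as "a possible
route to eliminate the necessity of V₃" from the only energetic crystallization theorem in ℝ³: V₃
serves solely to
force 24 tangencies in every twelve-shell, and "≥ 4 common neighbours for touching
twelve-coordinated pairs" forces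
the same by degree counting plus the 24-tangency theorem (doi:10.1016/j.cam.2013.03.036 = FT Thm
3.5). Imported
area: spherical codes / Delsarte–Bachoc–Vallentin SDP duality with exact rational certificates
(arXiv:math/0608426,
arXiv:1311.3789, doi:10.1137/20m1351692) and Flyspeck-style interval branch-and-bound — a
certificate technology,
pointed at a coupled two-sphere code (the refuters' pilots on the predecessor settle that the
one-sphere L12
cap-code shortcut only yields ≥ 3, so the coupling is essential). What it does that the open sibling
does not:
BrittleRungDescent keeps Hales's gap (no points in (1+η, 1.26)) in its LocalHalesKernel and must pay
for the empty
annulus on the Lennard-Jones energy side (LJBondSpread); here the kernel is gap-free — first-shell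
data only,
BondOrderTwelve strictly weaker than LJBondSpread / 0750 — and the price is moved to a finite,
potential-free
certificate. No item takes an unproved Literature fact (flyspeck_L12,
Hales2012_contactGraphFccOrHcp,
FlatleyEtAl2013_maxContacts) as hypothesis; LennardJonesMinimalDistance is PROVED in tree and no
longer appears.

RANKED CRUXES. #0 LocalClosePacking (target) — route target X_LJ∘X_geo: there is a bond length a > 0
such that in Lennard-Jones ground states all but o(N) particles have their soft first shell
(particles within (1+10⁻³)a, recentred, scaled by 1/a) 1/10-close after a linear isometry to the FCC
or the HCP kissing pattern; follows from BondOrderTwelve + GapFreeShellRigidity by the glue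
BondToShells. (why it might fail: fails iff a positive fraction of bulk LJ particles is not
FCC/HCP-coordinated within 10⁻³ (persistent decahedral/icosahedral order, LJ₁₃ is icosahedral) —
i.e. iff BondOrderTwelve fails or the kernel tolerance is too generous.) [arXiv:1407.0692,
arXiv:1504.01153, arXiv:1209.6043]
#2 TwoCentreFourCommon (crux) — Flatley–Theil Conjecture 2.2 verbatim (card F1/F2; identical
signature to the predecessor's stmt-3371, whose refuter evidence and queued kit jobs j000901/j001042
carry over): for Z ⊂ ℝ³ with pairwise distances ≥ 1 and N(z) the points at distance exactly 1, if
dist(z,z') = 1 and #N(z) = #N(z') = 12 then #(N(z) ∩ N(z')) ≥ 4 — equivalently at most 18 further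
balls touch a dimer of two touching twelve-kissed balls. Attack: coupled two-sphere
distinguished-point SDP (zonal + one-point-fixed harmonics on each sphere, coupled through ≤ 3
shared points and the phantom caps arccos(d/2) of the partner's non-common neighbours) with a
rationalised certificate, or interval branch-and-bound over the ≤ 23-ball configuration space; the
one-sphere L12 reduction is settled insufficient (gives ≥ 3 only). [difficulty: L] (why it might
fail: Unproved in print; the L12 one-sphere cap code only forces ≥3 (a 12-point 60°-code with 3
contacts and 8 points ≥78.1° from the pole exists, slack 0.76°); coupled c=3 searches reach min
distance 0.978 (deficit 2.2%) — a ≤23-ball counterexample may exist.) [arXiv:1407.0692,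
doi:10.1016/j.cam.2013.03.036, arXiv:math/0608426, arXiv:1311.3789, doi:10.1137/20m1351692,
arXiv:1209.6043, doi:10.3934/amc.2007.1.131]
#3 GapFreeShellRigidity (crux) — THE KERNEL (gap-free robust Fejes Tóth step, tolerance η ∈ [0,
10⁻³]): if S ⊂ ℝ³ is (1−η)-separated on the ball B(x,4), and x ∈ S and every point of S within 1+η
of x have exactly twelve points of S within 1+η, then the soft shell of x (translated to the origin)
is 1/10-close after a linear isometry to fccKissingPattern or hcpKissingPattern. Intended proof =
KernelGlue: SoftTwoCentreFourCommon gives every shell point ≥ 4 soft tangencies inside the shell,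
hence ≥ 48 ordered soft-tangent pairs, and RobustTangencyBound concludes; at η = 0 it is Conjecture
2.2 + the 24-tangency equality case. [deps: TwoCentreFourCommon] [difficulty: L] (why it might fail:
Needs soft Conj 2.2 AND effective rigidity: the centred (anti)cuboctahedron contact framework has
exactly one infinitesimal flex (rigidity rank 32 of 33), so 24-contact shells drift O(√η) ≈
0.03–0.05 at η=10⁻³; a 25-contact or 1/10-far shell below 10⁻³ kills the constant.)
[doi:10.1016/j.cam.2013.03.036, arXiv:1407.0692, arXiv:1209.6043, arXiv:1611.10297,
Literature.Barriers.AtomisticToContinuum.DecahedralSoftShell,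
Literature.Barriers.AtomisticToContinuum.FlexibleKissingArrangementsNarrow]
#4 BondOrderTwelve (crux) — LJ BOND ORDER (first shell only; strictly weaker than stmt-0750 and than
BrittleRungDescent's LJBondSpread — no empty annulus (1+η, 1.26) is claimed): there is a > 0 such
that for every sequence of Lennard-Jones ground states x^N in ℝ³ the fraction of particles i failing
[(1−10⁻³)a ≤ dist(x_i,x_j) for all j ≠ i, and exactly twelve j with dist(x_i,x_j) ≤ (1+10⁻³)a] tends
to 0 (expected a ≈ 0.971, the bulk LJ nearest-neighbour distance). Mechanism: a soft kissing bound
caps the count at 12 (Tammes-13 margin 57.14° < 59.86°), then energy accounting E(N) ≤ N e_hcp +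
O(N^(2/3)) with a bond/elastic/tail split forces twelve bonds and strain < 10⁻³ away from o(N)
defects. [difficulty: open-problem] (why it might fail: False iff a positive fraction of bulk LJ
particles is not 12-coordinated within 0.1% (LJ₁₃ icosahedral; decahedral motifs close at 0.67%
strain) or bulk strain ≥10⁻³ persists; no energy→coordination inequality without V₃ exists in 3-D.)
[arXiv:1504.01153, arXiv:1209.6043, arXiv:1605.00034,
Literature.Barriers.AtomisticToContinuum.IcosahedralClusters,
Literature.Barriers.AtomisticToContinuum.TetrahedralFrustration, stmt-AtomisticToContinuum-0750]
#5 ClosePackedCrystallizes (crux) — HINGE: if Lennard-Jones ground states are locally close-packed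
(LocalClosePacking) then IsCrystallizing lennardJones 3 — local limits of translated ground states
are windows of one lattice-periodic configuration. Content: FCC/HCP-close shells ⇒ combinatorial
Barlow layering (soft form of the PROVED HalesDSP_layerPackings_holds) ⇒ stacking selection inside
finite ground states by the r⁻⁶ tail (Hägg domination 0716/0737, certified interlayer couplings
0670) ⇒ a periodic (HCP-type) limit along a subsequence; uniform separation is the PROVED
LennardJonesMinimalDistance_holds, used inside the proof, not assumed. [deps: LocalClosePacking]
[difficulty: open-problem] (why it might fail: Stacking blindness: FCC/HCP shells never fix the
stacking; if optimal LJ stackings are aperiodic or power-free along every subsequence (Hägg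
domination unproved, |J₂|≈7e-5 uncertified) the implication fails although LocalClosePacking holds.)
[Literature.Barriers.AtomisticToContinuum.KissingTwelveDegeneracy,
Literature.Barriers.AtomisticToContinuum.ShortRangeStackingBlindness,
stmt-AtomisticToContinuum-0716, stmt-AtomisticToContinuum-0737, arXiv:1705.01751, arXiv:1504.01153]
#9 SoftTwoCentreFourCommon (support) — soft two-centre lemma, tolerance η ∈ [0, 10⁻³] (η = 0 is
literally TwoCentreFourCommon): Z (1−η)-separated, z ≠ z' with dist ≤ 1+η, each with exactly twelve
other points within 1+η ⇒ ≥ 4 points within 1+η of both. From TwoCentreFourCommon only an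
ineffective η₀ follows by compactness (a limit 13th contact is excluded by k(3) = 12); the explicit
10⁻³ is the certificate of crux 2 re-run with slack (numerical margin ≈ 2%). [difficulty: L]
[arXiv:1407.0692, arXiv:1209.6043, doi:10.1016/j.ejc.2008.07.017]
#9 RobustTangencyBound (support) — effective 24-tangency rigidity (FT Thm 3.5 =
Flatley–Tarasov–Taylor–Theil 2013 with explicit slack; FT Prop 3.3(2) made effective): for η ∈ [0,
10⁻³], twelve points with norms in [1−η, 1+η], pairwise ≥ 1−η, and ≥ 48 ordered pairs at distance ≤
1+η are 1/10-close after a linear isometry to the FCC or the HCP kissing pattern. At η = 0 this is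
the tree's named fact FlatleyEtAl2013_maxContacts (bookkeeping lemmas in
KissingContactMaximum.lean), to be PROVED, not assumed. [difficulty: L]
[doi:10.1016/j.cam.2013.03.036, arXiv:1407.0692, arXiv:1209.6043,
Literature.Geometry.DiscreteGeometry.FlatleyEtAl2013_maxContacts]
#9 KernelGlue (support) — glue of the foreseen split of GapFreeShellRigidity:
SoftTwoCentreFourCommon → RobustTangencyBound → GapFreeShellRigidity (apply the soft lemma to Z = S
∩ B(x,4) and each pair (x,y), y a soft neighbour: ≥ 4 soft-common neighbours give y−x ≥ 4
soft-tangent partners in the translated shell T, card T = 12, so ≥ 48 ordered pairs). Finite-set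
bookkeeping. [difficulty: provable-now] [arXiv:1407.0692]
#9 BondToShells (support) — glue to the target: BondOrderTwelve → GapFreeShellRigidity →
LocalClosePacking. Rescale a ground state by 1/a; a particle whose 4a-neighbourhood consists of
bond-good particles satisfies the kernel's hypotheses at η = 10⁻³; each bond-bad particle spoils ≤
(4.4995/0.4995)³ < 732 good ones (disjoint balls of radius 0.4995a), so o(N) bad ⇒ o(N)
non-close-packed; ground states are injective, so index sets and point sets match. [difficulty: M]
[arXiv:1504.01153]
#9 CrysEnergyLimit (support) — shared item stmt-AtomisticToContinuum-0626 (identical signature):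
E(N)/N → ⨅ over periodic configurations of ℝ³ of the Lennard-Jones energy per particle. Conjunct-(i)
input, not this route's focus. [difficulty: XL] [arXiv:1504.01153, stmt-AtomisticToContinuum-0626]
#9 CrysPeriodicMinAttained (support) — shared item stmt-AtomisticToContinuum-0627 (identical
signature): the infimum over periodic configurations of ℝ³ of the Lennard-Jones energy per particle
is attained. Conjunct-(i) input, not this route's focus. [difficulty: XL] [arXiv:1504.01153,
stmt-AtomisticToContinuum-0627]

TWO-LAYER PLAN. Foreseen glued splits (nothing filed as children now; the glue statements are filed
as support so the logic is typed):
GapFreeShellRigidity ⇐ SoftTwoCentreFourCommon → RobustTangencyBound → GapFreeShellRigidity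
(KernelGlue), once
TwoCentreFourCommon closes (its certificate re-run with slack is SoftTwoCentreFourCommon).
LocalClosePacking ⇐ BondOrderTwelve → GapFreeShellRigidity → LocalClosePacking (BondToShells).
ClosePackedCrystallizes ⇐ SoftLayering (close-packed LJ limits are soft Barlow stackings) →
StackingSelection (Hägg
domination 0737 + certified J_k 0670 inside finite ground states ⇒ period-2 windows along a
subsequence) →
ClosePackedCrystallizes — only after BondOrderTwelve or the kernel moves.

KILL CRITERIA. REFUTED TwoCentreFourCommon (an explicit 1-separated configuration: two touching
twelve-kissed centres sharing ≤ 3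
neighbours, i.e. ≥ 19 balls on a twelve-twelve dimer) closes the route outright (`close --reason
refuted:TwoCentreFourCommon`): the soft lemma and the kernel's only engine die with it; the witness
is itself a
Literature-worthy fact for FlexibleKissingArrangements. A 12-shell at tolerance ≤ 10⁻³ with ≥ 25
soft tangencies, or
with 24 tangencies yet 1/10-far from both patterns, refutes RobustTangencyBound /
GapFreeShellRigidity AT THIS
CONSTANT ⇒ pivot once: restate kernel, soft lemma, BondOrderTwelve and LocalClosePacking at 1/5000
(BondOrderTwelve is
equally plausible at any tolerance above the hcp bond split ~10⁻⁴); a second failure closes the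
route. BondOrderTwelve
refuted (LJ bulk not twelve-coordinated at 0.1%) kills every sphere-packing-heritage LJ line (this
one and
BrittleRungDescent's LJ end). ClosePackedCrystallizes refuted = aperiodic optimal LJ stacking =
conjunct (ii) itself
in doubt; close and hand the witness to a refutation route. If BrittleRungDescent's LocalHalesKernel
AND LJBondSpread
are both PROVED first, this route is superseded for the summit (crux 2 stays a Literature-worthy
theorem).

NOT DECOMPOSED YET. The certificates behind the kernel (soft kissing ≤ 12 at 10⁻³, the coupled
two-sphere SDP or branch-and-bound,
the effective 24-tangency classification with the one-flex second-order analysis) ride as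
`--supports` lemmas of
TwoCentreFourCommon / RobustTangencyBound, never as items. No flyspeck_L12- or Hales2012-conditional
statement is
filed (it would close nothing and would put an unproved XL fact in the cone); conditional lemmas may
land in
Theorems as supports. The energy interior of BondOrderTwelve (bond/elastic/tail split in 3-D,
surface O(N^(2/3)),
the value of a, second-shell pricing of 13-coordination) and the whole interior of
ClosePackedCrystallizes
(layering at positive tolerance, fault counting, Hägg domination, the HCP-vs-FCC 10⁻⁴ selection)
wait for crux 2
or 3 to move. Flatley–Theil's own pay-off (their Thm 1.1 with Ψ = 0 for the α-localized PAIR class —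
not
Lennard-Jones, barrier LocalizedPotentialsExcludeLennardJones) is deliberately not filed.

CHEAPEST FALSIFIER. Already run by refuters on the predecessor item (stmt-3371 evidence,
2026-08-15): the one-sphere L12 cap code with
3 contacts is FEASIBLE (slack 0.76°; c = 2/1/0 infeasible by 0.63°/2.6°/3.3°), so only the coupled
problem can
decide Conjecture 2.2; coupled annealing at c = 3 reached min distance 0.973–0.978 (FCC control c =
4 reaches
1.0002), no counterexample — kit jobs j000901 (c22-full) and j001042 (coupled, 320 restarts) are
queued and
auto-attach to the item. Next cheapest: (a) push the coupled c = 3 search with the dimer formulation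
(≥ 19 unit
balls on a twelve-twelve dimer; ≤ 69 coordinates, penalty method, 10³ restarts); (b) for the kernel
constant,
maximise the matching distance to both patterns over 13-point configurations satisfying the 36 soft
contacts at
η = 10⁻³ along the computed flex direction (39-variable NLP): a value > 1/10 refutes
RobustTangencyBound at 10⁻³.
Own check this pass: exact rigidity ranks of the centred cuboctahedron / anticuboctahedron (rank 32
of 33 each:
one infinitesimal flex, four self-stresses) — the constant in (b) is live, not the statement.

NUMBERS. Contact angle 60°; Hales gap 2h₀ = 2.52 radii = 1.26 diameters ↔ 78.10° (arXiv:1209.6043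
Lemma 2); Tammes(13) =
57.1367°; one-sphere cap code (pole + 3 at 60° + 8 at ≥ 78.1°, pairwise ≥ 60°): feasible, slack
0.76°, still at
gap 80°, infeasible at 82° (refuter g41-4); coupled c = 3: best min distance 0.978 (g41-55), 0.975
(g41-20), 0.973
(g41-4 pilots); decahedral closure threshold (2 sin 36°)²((1−η)² − (1+η)²/4) ≤ (1+η)² ⇔ η ≥ η⋆ ≈
0.0067 (tree:
DecahedralSoftShell, 25 soft contacts, axial pair with FIVE common neighbours at η = 1/100); kernel
tolerance 10⁻³
< η⋆; five points round a unit bond at 72° are 2·(√3/2)·sin 36° = 1.018 apart (no contact below η =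
0.018);
centred (anti)cuboctahedron: 13 nodes, 36 bars, rigidity rank 32, one flex; icosahedral shell
edge/radius 1.0515;
LJ bulk nearest-neighbour distance a ≈ 0.971, hcp bond split ~10⁻⁴; FCC/HCP patterns: 24 tangencies
= 48 ordered
pairs, node degree 4; closeness threshold 1/10 < 1/2 (pattern points ≥ 1 apart). Items at open: 12
(4 cruxes).

DEFINITION REQUESTS. None: fccKissingPattern, hcpKissingPattern, ShellCloseTo
(KissingPatterns.lean), IsGroundState, lennardJones,
IsCrystallizing, PeriodicConfiguration, groundStateEnergy exist; FlatleyEtAl2013_maxContacts is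
already vendored
(KissingContactMaximum.lean, cite items wi-11630 / wi-11405).

Novelty: Searches (2026-08-15, this pass + the predecessor's recorded ones): lit read arXiv:1407.0692 p. 7
(Conjecture 2.2
verbatim, the "possible route to eliminate V₃" sentence, the degree-4 remark); ledger negatives (6
entries, 2 in
this sub-problem, neither a two-centre statement); the two refuter novelty audits on the card (65
works citing
FT2015 by title: none addresses Conj. 2.2) and four refuter evidence files on stmt-3371 (numerical,
no literature
hit); predecessor: lit search crossref "packing twelve spherical caps maximize tangencies" (8; FTTT
2013), zbmath
"twelve neighbour packings unit balls" (2: Böröczky–Szabó), lit galaxy search "codes in spherical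
caps" --star all
(5: Bachoc SDP slides, Bachoc–Vallentin, Musin, Bezdek), lit search --hybrid "two touching balls
twelve neighbours
share four common neighbours cuboctahedron" (6 books, nothing on the two-ball statement), lit
frontier / bridges
AtomisticToContinuum (kinetic-theory dominated). This pass's `lit search "unit balls touching two
tangent unit balls
kissing number dimer"` returned rc 75 (searchd unavailable) twice; recorded in NOTES.md.
Nearest prior art found: arXiv:1407.0692 (the printed open conjecture and its intended use);
doi:10.1016/j.cam.2013.03.036
(24-tangency theorem, η = 0, computer-assisted); arXiv:1209.6043 + doi:10.1007/s10474-015-0527-4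
(the GLOBAL
all-balls-twelve-kissed theorem); doi:10.3934/amc.2007.1.131, doi:10.1016/j.ejc.2008.07.017,
arXiv:math/0608426,
arXiv:1311.3789, doi:10.1137/20m1351692  [refs: 10.1016/j.cam.2013.03.036, 10.1007/s10474-015-0527-4, 10.3934/amc.2007.1.131, 10.1016/j.ejc.2008.07.017, 10.1137/20m1351692, 1407.0692, 1209.6043, math/0608426, 1311.3789, doi:10.1016/j.cam.2013.03.036, doi:10.1007/s10474-015-0527-4, doi:10.3934/amc.2007.1.131, doi:10.1016/j.ejc.2008.07.017, doi:10.1137/20m1351692]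

Barriers (technique_class: two-centre-kissing-rigidity, cap-code-sdp, certificates): - technique_class: two-centre-kissing-rigidity, cap-code-sdp, certificates
- Literature.Barriers.AtomisticToContinuum.FlexibleKissingArrangements: APPLIES to any ONE-shell
count-only inference (icosahedral witness, bond number 0, 1/40-far); evaded as its narrowed form
prescribes (evasion (i), BOND COUNT): closeness is inferred from 24 soft tangencies, and the
tangencies come from the SECOND centre — the icosahedral centre's neighbours are not
twelve-coordinated at 10⁻³ (their would-be bonds are 5% long).
- Literature.Barriers.AtomisticToContinuum.FlexibleKissingArrangementsNarrow: same; it names the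
24-tangency theorem as the known evasion, which RobustTangencyBound makes effective at 10⁻³.
- Literature.Barriers.AtomisticToContinuum.DecahedralSoftShell: APPLIES to soft local kissing
inferences at tolerance ≥ η⋆ ≈ 0.0067 (D₅ₕ shell, 25 contacts, an axial pair with five common
neighbours); evaded by the tolerance 10⁻³ < η⋆ — below it five tetrahedra cannot close round a bond
(in-ring distance 1.018 > 1.001), and in the gap-free setting a ring atom with only 3 in-cluster
contacts cannot reach twelve.
- Literature.Barriers.AtomisticToContinuum.TetrahedralFrustration: used as a resource, not suffered:
the 7.36° five-tetrahedra deficit is exactly what keeps polytetrahedral shells out of the kernel's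
hypotheses at 10⁻³.
- Literature.Barriers.AtomisticToContinuum.IcosahedralClusters: APPLIES at finite N (LJ₁₃
icosahedral beats cuboctahedral); evaded only asymptotically — every LJ ite

Novelty grade: new-combination — ROUTE REVIEW (refuter rreview-0815T18-19): KEEP OPEN; full write-up + derivations attached as route evidence REVIEW_TwoCentreKissingKernel.md. Conforming successor of TwoCentreKissing (retired for D-0027 §2.1 only) ⇒ not a recombination of closed routes; closes native-OK, staffable 0/32. Defs audite (refuter refuter-rreview-0815T18-19-0, 2026-08-15T19:31:51Z; prior: arXiv:1407.0692 §2.1 Conj 2.2 + Thm 3.5; doi:10.1016/j.cam.2013.03.036; arXiv:1209.6043; Literature.Barriers.AtomisticToContinuum.DecahedralSoftShell; kit j004122)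

History (route lifecycle, newest last):
- 2026-08-16T03:49:26Z · AUTO-CRUX (backfill): LocalClosePacking — hypotheses of the deciding theorem that nothing in the route derives are cruxes (operator:999:586464)
- 2026-08-25T15:20:43Z · DORMANT — reconciler: no traction for 7.8 d (last activity item-evidence-added at 2026-08-17T19:18:23Z); parked, not closed — `ledger route dormant route-AtomisticToConti (operator:999:35622)

sub-problem: Crystallization · status: dormant · opened planner-plancard-AtomisticToContinuum-Crystal-8023f413-g2-0 2026-08-15T18:49:21Z · rev 2 · ledger route-AtomisticToContinuum-TwoCentreKissingKernel
GENERATED by the gate from the ledger (D-0016/17). Provers cite these decls: `theorem foo : Summit.AtomisticToContinuum.Crystallization.Theses.TwoCentreKissingKernel.<Decl> := …` in Summits/AtomisticToContinuum/Crystallization/Theorems/<Name>.lean.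
-/

namespace Summit.AtomisticToContinuum.Crystallization.Theses.TwoCentreKissingKernel

open scoped BigOperators Topology Manifold Classical MeasureTheory ProbabilityTheory Matrix InnerProductSpace ComplexConjugate ContinuousMap
open Filter Set Function TopologicalSpace MeasureTheory

attribute [summit_statement] _root_.Crystallization

/-- item stmt-AtomisticToContinuum-12076 · crux (kind.auto-crux: conjecture-grade) · rank 0 · open · by planner
why it might fail: fails iff a positive fraction of bulk LJ particles is not FCC/HCP-coordinated within 10⁻³ (persistent decahedral/icosahedral order, LJ₁₃ is icosahedral) — i.e. iff BondOrderTwelve fails or the kernel tolerance is too generous.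
sources: arXiv:1407.0692, arXiv:1504.01153, arXiv:1209.6043
[target] route target X_LJ∘X_geo: there is a bond length a > 0 such that in Lennard-Jones ground
states all but o(N) particles have their soft first shell (particles within (1+10⁻³)a, recentred,
scaled by 1/a) 1/10-close after a linear isometry to the FCC or the HCP kissing pattern; follows
from BondOrderTwelve + GapFreeShellRigidity by the glue BondToShells. -/
@[route_item "route-AtomisticToContinuum-TwoCentreKissingKernel", crux]
def LocalClosePacking : Prop :=
  ∃ a : ℝ, 0 < a ∧ ∀ x : (N : ℕ) → (Fin N → EuclideanSpace ℝ (Fin 3)), (∀ N, Literature.MathematicalPhysics.StatisticalMechanics.IsGroundState Literature.MathematicalPhysics.StatisticalMechanics.lennardJones (x N)) → Filter.Tendsto (fun N : ℕ => (Nat.card {i : Fin N // ¬ ∃ T : Finset (EuclideanSpace ℝ (Fin 3)), (↑T : Set (EuclideanSpace ℝ (Fin 3))) = (fun j : Fin N => a⁻¹ • (x N j - x N i)) '' {j : Fin N | j ≠ i ∧ dist (x N i) (x N j) ≤ (1 + 1 / 1000) * a} ∧ (Literature.Geometry.DiscreteGeometry.ShellCloseTo (1 / 10) T Literature.Geometry.DiscreteGeometry.fccKissingPattern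 ∨ Literature.Geometry.DiscreteGeometry.ShellCloseTo (1 / 10) T Literature.Geometry.DiscreteGeometry.hcpKissingPattern)} : ℝ) / N) Filter.atTop (nhds 0)

/-- item stmt-AtomisticToContinuum-12077 · crux · rank 2 · open · by planner
why it might fail: Unproved in print; the L12 one-sphere cap code only forces ≥3 (a 12-point 60°-code with 3 contacts and 8 points ≥78.1° from the pole exists, slack 0.76°); coupled c=3 searches reach min distance 0.978 (deficit 2.2%) — a ≤23-ball counterexample may exist.
sources: arXiv:1407.0692, doi:10.1016/j.cam.2013.03.036, arXiv:math/0608426, arXiv:1311.3789, doi:10.1137/20m1351692, arXiv:1209.6043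
[crux] Flatley–Theil Conjecture 2.2 verbatim (card F1/F2; identical signature to the predecessor's
stmt-3371, whose refuter evidence and queued kit jobs j000901/j001042 carry over): for Z ⊂ ℝ³ with
pairwise distances ≥ 1 and N(z) the points at distance exactly 1, if dist(z,z') = 1 and #N(z) =
#N(z') = 12 then #(N(z) ∩ N(z')) ≥ 4 — equivalently at most 18 further balls touch a dimer of two
touching twelve-kissed balls. Attack: coupled two-sphere distinguished-point SDP (zonal +
one-point-fixed harmonics on each sphere, coupled through ≤ 3 shared points and the phantom caps
arccos(d/2) of the partner's non-common neighbours) with a rationalised certificate, or interval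
branch-and-bound over the ≤ 23-ball configuration space; the one-sphere L12 reduction is settled
insufficient (gives ≥ 3 only). [difficulty: L] -/
@[route_item "route-AtomisticToContinuum-TwoCentreKissingKernel", crux]
def TwoCentreFourCommon : Prop :=
  ∀ Z : Set (EuclideanSpace ℝ (Fin 3)), (∀ x ∈ Z, ∀ y ∈ Z, x ≠ y → 1 ≤ dist x y) → ∀ z ∈ Z, ∀ z' ∈ Z, dist z z' = 1 → {w ∈ Z | dist w z = 1}.ncard = 12 → {w ∈ Z | dist w z' = 1}.ncard = 12 → 4 ≤ {w ∈ Z | dist w z = 1 ∧ dist w z' = 1}.ncard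

/-- item stmt-AtomisticToContinuum-12078 · crux · rank 3 · open · by planner
why it might fail: Needs soft Conj 2.2 AND effective rigidity: the centred (anti)cuboctahedron contact framework has exactly one infinitesimal flex (rigidity rank 32 of 33), so 24-contact shells drift O(√η) ≈ 0.03–0.05 at η=10⁻³; a 25-contact or 1/10-far shell below 10⁻³ kills the constant.
sources: doi:10.1016/j.cam.2013.03.036, arXiv:1407.0692, arXiv:1209.6043, arXiv:1611.10297, Literature.Barriers.AtomisticToContinuum.DecahedralSoftShell, Literature.Barriers.AtomisticToContinuum.FlexibleKissingArrangementsNarrow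
[crux] THE KERNEL (gap-free robust Fejes Tóth step, tolerance η ∈ [0, 10⁻³]): if S ⊂ ℝ³ is
(1−η)-separated on the ball B(x,4), and x ∈ S and every point of S within 1+η of x have exactly
twelve points of S within 1+η, then the soft shell of x (translated to the origin) is 1/10-close
after a linear isometry to fccKissingPattern or hcpKissingPattern. Intended proof = KernelGlue:
SoftTwoCentreFourCommon gives every shell point ≥ 4 soft tangencies inside the shell, hence ≥ 48
ordered soft-tangent pairs, and RobustTangencyBound concludes; at η = 0 it is Conjecture 2.2 + the
24-tangency equality case. [deps: TwoCentreFourCommon] [difficulty: L] -/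
@[route_item "route-AtomisticToContinuum-TwoCentreKissingKernel", crux]
def GapFreeShellRigidity : Prop :=
  ∀ η : ℝ, 0 ≤ η → η ≤ 1 / 1000 → ∀ (S : Set (EuclideanSpace ℝ (Fin 3))) (x : EuclideanSpace ℝ (Fin 3)), x ∈ S → (∀ y ∈ S, ∀ y' ∈ S, dist x y ≤ 4 → dist x y' ≤ 4 → y ≠ y' → 1 - η ≤ dist y y') → (∀ y ∈ S, dist x y ≤ 1 + η → {w ∈ S | w ≠ y ∧ dist y w ≤ 1 + η}.ncard = 12) → ∃ T : Finset (EuclideanSpace ℝ (Fin 3)), (↑T : Set (EuclideanSpace ℝ (Fin 3))) = (fun y => y - x) '' {y ∈ S | y ≠ x ∧ dist x y ≤ 1 + η} ∧ (Literature.Geometry.DiscreteGeometry.ShellCloseTo (1 / 10) T Literature.Geometry.DiscreteGeometry.fccKissingPattern ∨ Literature.Geometry.DiscreteGeometry.ShellCloseTo (1 / 10) T Literature.Geometry.DiscreteGeometry.hcpKissingPattern)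

/-- item stmt-AtomisticToContinuum-12079 · crux · rank 4 · open · by planner
why it might fail: False iff a positive fraction of bulk LJ particles is not 12-coordinated within 0.1% (LJ₁₃ icosahedral; decahedral motifs close at 0.67% strain) or bulk strain ≥10⁻³ persists; no energy→coordination inequality without V₃ exists in 3-D.
sources: arXiv:1504.01153, arXiv:1209.6043, arXiv:1605.00034, Literature.Barriers.AtomisticToContinuum.IcosahedralClusters, Literature.Barriers.AtomisticToContinuum.TetrahedralFrustration, stmt-AtomisticToContinuum-0750
[crux] LJ BOND ORDER (first shell only; strictly weaker than stmt-0750 and than BrittleRungDescent's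
LJBondSpread — no empty annulus (1+η, 1.26) is claimed): there is a > 0 such that for every sequence
of Lennard-Jones ground states x^N in ℝ³ the fraction of particles i failing [(1−10⁻³)a ≤
dist(x_i,x_j) for all j ≠ i, and exactly twelve j with dist(x_i,x_j) ≤ (1+10⁻³)a] tends to 0
(expected a ≈ 0.971, the bulk LJ nearest-neighbour distance). Mechanism: a soft kissing bound caps
the count at 12 (Tammes-13 margin 57.14° < 59.86°), then energy accounting E(N) ≤ N e_hcp +
O(N^(2/3)) with a bond/elastic/tail split forces twelve bonds and strain < 10⁻³ away from o(N)
defects. [difficulty: open-problem] -/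
@[route_item "route-AtomisticToContinuum-TwoCentreKissingKernel", crux]
def BondOrderTwelve : Prop :=
  ∃ a : ℝ, 0 < a ∧ ∀ x : (N : ℕ) → (Fin N → EuclideanSpace ℝ (Fin 3)), (∀ N, Literature.MathematicalPhysics.StatisticalMechanics.IsGroundState Literature.MathematicalPhysics.StatisticalMechanics.lennardJones (x N)) → Filter.Tendsto (fun N : ℕ => (Nat.card {i : Fin N // ¬ ((∀ j : Fin N, j ≠ i → (1 - 1 / 1000) * a ≤ dist (x N i) (x N j)) ∧ Nat.card {j : Fin N // j ≠ i ∧ dist (x N i) (x N j) ≤ (1 + 1 / 1000) * a} = 12)} : ℝ) / N) Filter.atTop (nhds 0)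

/-- item stmt-AtomisticToContinuum-12080 · crux · rank 5 · open · by planner
why it might fail: Stacking blindness: FCC/HCP shells never fix the stacking; if optimal LJ stackings are aperiodic or power-free along every subsequence (Hägg domination unproved, |J₂|≈7e-5 uncertified) the implication fails although LocalClosePacking holds.
sources: Literature.Barriers.AtomisticToContinuum.KissingTwelveDegeneracy, Literature.Barriers.AtomisticToContinuum.ShortRangeStackingBlindness, stmt-AtomisticToContinuum-0716, stmt-AtomisticToContinuum-0737, arXiv:1705.01751, arXiv:1504.01153
[crux] HINGE: if Lennard-Jones ground states are locally close-packed (LocalClosePacking) then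
IsCrystallizing lennardJones 3 — local limits of translated ground states are windows of one
lattice-periodic configuration. Content: FCC/HCP-close shells ⇒ combinatorial Barlow layering (soft
form of the PROVED HalesDSP_layerPackings_holds) ⇒ stacking selection inside finite ground states by
the r⁻⁶ tail (Hägg domination 0716/0737, certified interlayer couplings 0670) ⇒ a periodic
(HCP-type) limit along a subsequence; uniform separation is the PROVED
LennardJonesMinimalDistance_holds, used inside the proof, not assumed. [deps: LocalClosePacking]
[difficulty: open-problem] -/
@[route_item "route-AtomisticToContinuum-TwoCentreKissingKernel", crux]
def ClosePackedCrystallizes : Prop :=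
  LocalClosePacking → Literature.MathematicalPhysics.StatisticalMechanics.IsCrystallizing Literature.MathematicalPhysics.StatisticalMechanics.lennardJones 3

/-- item stmt-AtomisticToContinuum-0626 · support · rank 9 · closed · proved by Summit.AtomisticToContinuum.Crystallization.Theorems.crysEnergyLimit_proof @ de27d46e58f4 (prover) · by planner
sources: arXiv:1504.01153, stmt-AtomisticToContinuum-0626
Energetic crystallization: E(N)/N converges to the infimum over periodic (multi-lattice)
configurations of the LJ energy per particle in d = 3. Lower bound liminf ≥ ⨅ is the content ((a)
local optimality + (d) + surface term O(N^{2/3})); upper bound is filed separately. -/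
@[route_item "route-AtomisticToContinuum-TwoCentreKissingKernel", crux]
def CrysEnergyLimit : Prop :=
  Filter.Tendsto (fun N : ℕ => Literature.MathematicalPhysics.StatisticalMechanics.groundStateEnergy Literature.MathematicalPhysics.StatisticalMechanics.lennardJones 3 N / N) Filter.atTop (nhds (⨅ Q : Literature.MathematicalPhysics.StatisticalMechanics.PeriodicConfiguration 3, Q.energyPerParticle Literature.MathematicalPhysics.StatisticalMechanics.lennardJones))

/-- `CrysEnergyLimit` holds: proved by `Summit.AtomisticToContinuum.Crystallization.Theorems.crysEnergyLimit_proof` @ de27d46e58f4. -/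
theorem CrysEnergyLimit_holds : CrysEnergyLimit := _root_.Summit.AtomisticToContinuum.Crystallization.Theorems.crysEnergyLimit_proof

/-- item stmt-AtomisticToContinuum-0627 · support · rank 9 · open · by planner
sources: arXiv:1504.01153, stmt-AtomisticToContinuum-0627
The infimum over periodic configurations of ℝ³ of the Lennard-Jones energy per particle is attained
(by some lattice G and finite motif F). Needs stacking selection (c) + compactness of near-optimal
periodic configurations at bounded density / bounded-below distances; refuted if optimal LJ
stackings are aperiodic with unattained infimum (route RefuteCrystalPeriodicMin). -/
@[route_item "route-AtomisticToContinuum-TwoCentreKissingKernel", crux]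
def CrysPeriodicMinAttained : Prop :=
  ∃ P : Literature.MathematicalPhysics.StatisticalMechanics.PeriodicConfiguration 3, IsLeast (Set.range fun Q : Literature.MathematicalPhysics.StatisticalMechanics.PeriodicConfiguration 3 => Q.energyPerParticle Literature.MathematicalPhysics.StatisticalMechanics.lennardJones) (P.energyPerParticle Literature.MathematicalPhysics.StatisticalMechanics.lennardJones)

/-- item stmt-AtomisticToContinuum-12081 · support · rank 9 · open · by planner
sources: arXiv:1407.0692, arXiv:1209.6043, doi:10.1016/j.ejc.2008.07.017
[support] soft two-centre lemma, tolerance η ∈ [0, 10⁻³] (η = 0 is literally TwoCentreFourCommon): Z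
(1−η)-separated, z ≠ z' with dist ≤ 1+η, each with exactly twelve other points within 1+η ⇒ ≥ 4
points within 1+η of both. From TwoCentreFourCommon only an ineffective η₀ follows by compactness (a
limit 13th contact is excluded by k(3) = 12); the explicit 10⁻³ is the certificate of crux 2 re-run
with slack (numerical margin ≈ 2%). [difficulty: L] -/
@[route_item "route-AtomisticToContinuum-TwoCentreKissingKernel", crux]
def SoftTwoCentreFourCommon : Prop :=
  ∀ η : ℝ, 0 ≤ η → η ≤ 1 / 1000 → ∀ Z : Set (EuclideanSpace ℝ (Fin 3)), (∀ x ∈ Z, ∀ y ∈ Z, x ≠ y → 1 - η ≤ dist x y) → ∀ z ∈ Z, ∀ z' ∈ Z, z ≠ z' → dist z z' ≤ 1 + η → {w ∈ Z | w ≠ z ∧ dist w z ≤ 1 + η}.ncard = 12 → {w ∈ Z | w ≠ z' ∧ dist w z' ≤ 1 + η}.ncard = 12 → 4 ≤ {w ∈ Z | w ≠ z ∧ w ≠ z' ∧ dist w z ≤ 1 + η ∧ dist w z' ≤ 1 + η}.ncard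

/-- item stmt-AtomisticToContinuum-12082 · support · rank 9 · open · by planner
sources: doi:10.1016/j.cam.2013.03.036, arXiv:1407.0692, arXiv:1209.6043, Literature.Geometry.DiscreteGeometry.FlatleyEtAl2013_maxContacts
[support] effective 24-tangency rigidity (FT Thm 3.5 = Flatley–Tarasov–Taylor–Theil 2013 with
explicit slack; FT Prop 3.3(2) made effective): for η ∈ [0, 10⁻³], twelve points with norms in [1−η,
1+η], pairwise ≥ 1−η, and ≥ 48 ordered pairs at distance ≤ 1+η are 1/10-close after a linear
isometry to the FCC or the HCP kissing pattern. At η = 0 this is the tree's named fact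
FlatleyEtAl2013_maxContacts (bookkeeping lemmas in KissingContactMaximum.lean), to be PROVED, not
assumed. [difficulty: L] -/
@[route_item "route-AtomisticToContinuum-TwoCentreKissingKernel", crux]
def RobustTangencyBound : Prop :=
  ∀ η : ℝ, 0 ≤ η → η ≤ 1 / 1000 → ∀ T : Finset (EuclideanSpace ℝ (Fin 3)), T.card = 12 → (∀ y ∈ T, 1 - η ≤ ‖y‖ ∧ ‖y‖ ≤ 1 + η) → (∀ y ∈ T, ∀ y' ∈ T, y ≠ y' → 1 - η ≤ dist y y') → 48 ≤ Nat.card {q : ↥T × ↥T // q.1 ≠ q.2 ∧ dist (q.1 : EuclideanSpace ℝ (Fin 3)) q.2 ≤ 1 + η} → Literature.Geometry.DiscreteGeometry.ShellCloseTo (1 / 10) T Literature.Geometry.DiscreteGeometry.fccKissingPattern ∨ Literature.Geometry.DiscreteGeometry.ShellCloseTo (1 / 10) T Literature.Geometry.DiscreteGeometry.hcpKissingPattern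

/-- item stmt-AtomisticToContinuum-12083 · support · rank 9 · closed · proved by Summit.AtomisticToContinuum.Crystallization.Theorems.kernelGlue_proof @ 8a75990e2b58 (prover) · by planner
sources: arXiv:1407.0692
[support] glue of the foreseen split of GapFreeShellRigidity: SoftTwoCentreFourCommon →
RobustTangencyBound → GapFreeShellRigidity (apply the soft lemma to Z = S ∩ B(x,4) and each pair
(x,y), y a soft neighbour: ≥ 4 soft-common neighbours give y−x ≥ 4 soft-tangent partners in the
translated shell T, card T = 12, so ≥ 48 ordered pairs). Finite-set bookkeeping. [difficulty:
provable-now] -/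
@[route_item "route-AtomisticToContinuum-TwoCentreKissingKernel", crux]
def KernelGlue : Prop :=
  SoftTwoCentreFourCommon → RobustTangencyBound → GapFreeShellRigidity

/-- item stmt-AtomisticToContinuum-12084 · support · rank 9 · closed · proved by Summit.AtomisticToContinuum.Crystallization.Theorems.bondToShells_proof @ 71fc88d526e0 (prover) · by planner
sources: arXiv:1504.01153
[support] glue to the target: BondOrderTwelve → GapFreeShellRigidity → LocalClosePacking. Rescale a
ground state by 1/a; a particle whose 4a-neighbourhood consists of bond-good particles satisfies the
kernel's hypotheses at η = 10⁻³; each bond-bad particle spoils ≤ (4.4995/0.4995)³ < 732 good ones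
(disjoint balls of radius 0.4995a), so o(N) bad ⇒ o(N) non-close-packed; ground states are
injective, so index sets and point sets match. [difficulty: M] -/
@[route_item "route-AtomisticToContinuum-TwoCentreKissingKernel", crux]
def BondToShells : Prop :=
  BondOrderTwelve → GapFreeShellRigidity → LocalClosePacking

/-- item stmt-AtomisticToContinuum-12085 · assembly · rank 1 · closed · proved by Summit.AtomisticToContinuum.Crystallization.Theorems.twoCentreKissingKernel_assembly_proof @ a32097947c67 (prover) · by planner
sources: arXiv:1504.01153, arXiv:1407.0692
[assembly] TwoCentreFourCommon → GapFreeShellRigidity → BondOrderTwelve → BondToShells →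
ClosePackedCrystallizes → CrysPeriodicMinAttained → CrysEnergyLimit → Crystallization (the
sub-problem Statement decl `_root_.Crystallization`). -/
@[route_item "route-AtomisticToContinuum-TwoCentreKissingKernel", crux]
def Assembly : Prop :=
  TwoCentreFourCommon → GapFreeShellRigidity → BondOrderTwelve → BondToShells → ClosePackedCrystallizes → CrysPeriodicMinAttained → CrysEnergyLimit → _root_.Crystallization

/-! D-0027 §2.1 — DECIDING THEOREM (planner-authored via `route open/edit --closes-file`; by planner-plancard-AtomisticToContinuum-Crystal-8023f413-g2-0 2026-08-15T18:49:23Z):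
its hypotheses are this route's items and its conclusion the sub-problem Statement (glue_lint), and it elaborates with this file. -/

@[closes "route-AtomisticToContinuum-TwoCentreKissingKernel"] theorem closes : LocalClosePacking → TwoCentreFourCommon → GapFreeShellRigidity → BondOrderTwelve → ClosePackedCrystallizes → SoftTwoCentreFourCommon → RobustTangencyBound → KernelGlue → BondToShells → CrysEnergyLimit → CrysPeriodicMinAttained → Assembly → _root_.Crystallization := by
  intro _ _ hK hB hCP _ _ _ hBS hlim hmin _
  obtain ⟨P, hP⟩ := hmin
  refine ⟨⟨P, hP, ?_⟩, hCP (hBS hB hK)⟩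
  have h : (⨅ Q : Literature.MathematicalPhysics.StatisticalMechanics.PeriodicConfiguration 3, Q.energyPerParticle Literature.MathematicalPhysics.StatisticalMechanics.lennardJones) = P.energyPerParticle Literature.MathematicalPhysics.StatisticalMechanics.lennardJones := hP.csInf_eq
  unfold CrysEnergyLimit at hlim
  rw [h] at hlim
  exact hlim

end Summit.AtomisticToContinuum.Crystallization.Theses.TwoCentreKissingKernel
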